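import Mathlib
import Summits.CriticalPhenomena.Ising3DConformalLimit.Theses.HarmonicMomentsIsotropy
import Summits.CriticalPhenomena.Ising3DConformalLimit.Theorems.HarmonicMomentsIsotropyHarmonicDilution
import Summits.CriticalPhenomena.Ising3DConformalLimit.Theorems.HarmonicMomentsIsotropyHarmonicDilutionSymmetric
import Summits.CriticalPhenomena.Ising3DConformalLimit.Theorems.HarmonicMomentsIsotropyHarmonicDilutionReynolds
import Summits.CriticalPhenomena.Ising3DConformalLimit.Theorems.HarmonicMomentsIsotropyHarmonicDilutionQuarticSymmetrization
import Summits.CriticalPhenomena.Ising3DConformalLimit.Theorems.HarmonicMomentsIsotropyHarmonicDilutionQuartic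
import HarnessLib

/-!
# Route HarmonicMomentsIsotropy — the first instance of `HarmonicDilution` as an axial fourth moment

Item `stmt-CriticalPhenomena-6034` (`HarmonicDilution`).  Its first open instance is the `K₄`
family `a_{K₄,m}(β) = ∑_x K₄(x)|x|^{2m}G_β(x) / ∑_x |x|^{4+2m}G_β(x) → 0` as `β ↑ β_c(3)`,
`K₄(x) = ∑ xᵢ⁴ - (3/5)|x|⁴`, `G_β = ⟨σ₀σ_x⟩^∅_β` on `ℤ³` (`harmonicDilution_K4`,
`harmonicDilution_degree_four_iff_K4` in `HarmonicMomentsIsotropyHarmonicDilutionQuartic.lean`).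
This file restates that instance as a statement about ONE positive, directly measurable quantity,
the normalised axial fourth moment — the form in which high-temperature series or Monte-Carlo data
test the milestone (the route's cheapest falsifier):

* `axialFourthMoment_eq` — for `0 ≤ β < β_c(3)` and every `m`,
  `∑_x x₀⁴|x|^{2m}G_β(x) = (1/3)·∑_x K₄(x)|x|^{2m}G_β(x) + (1/5)·∑_x |x|^{4+2m}G_β(x)`
  (coordinate-permutation invariance of `G_β` and `|x|`, and `∑ᵢ xᵢ⁴ = K₄ + (3/5)|x|⁴`);
* `K4_family_iff_axialFourthMoment` — the `K₄` family tends to `0` iff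
  `∑_x x₀⁴|x|^{2m}G_β(x) / ∑_x |x|^{4+2m}G_β(x) → 1/5` for every `m` (`1/5 = ∫_{S²} ω₀⁴ dσ/4π`,
  the isotropic value);
* `harmonicDilution_axialFourthMoment` — hence `HarmonicDilution` implies
  `∑_x x₀⁴|x|^{2m}⟨σ₀σ_x⟩^∅_β / ∑_x |x|^{4+2m}⟨σ₀σ_x⟩^∅_β → 1/5` as `β ↑ β_c(3)`, for every `m ≥ 0`;
* `harmonicDilution_iff_axialFourthMoment_and_invariant_six_le` — and the item is EQUIVALENT to
  these axial limits together with its restriction to the `B₃`-invariant harmonics of even degree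
  `≥ 6` (`harmonicDilution_iff_K4_and_invariant_six_le`).
-/

namespace Summit.CriticalPhenomena.Ising3DConformalLimit.Theorems

open Filter Topology Set
open Literature.Probability.LatticeModels
open Summit.CriticalPhenomena.Ising3DConformalLimit.Theses.HarmonicMomentsIsotropy

/-- Summability of the `j`-th axial fourth moment weight below `β_c`. -/
theorem summable_axialFourth {β : ℝ} (hβ : 0 ≤ β) (hβc : β < criticalBeta 3) (j : Fin 3) (m : ℕ) :
    Summable fun x : Site 3 => ((x j : ℤ) : ℝ) ^ 4 *
      Real.sqrt (∑ i, ((x i : ℤ) : ℝ) ^ 2) ^ (2 * m) * twoPointFree 3 β x := by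
  refine (summable_polyMoment hβ hβc (MvPolynomial.X j ^ 4) (MvPolynomial.isHomogeneous_X_pow j 4)
    m).congr fun x => ?_
  simp

/-- Coordinate-permutation invariance: every axial fourth moment equals the `0`-th one. -/
theorem axialFourth_eq_axialFourth_zero (β : ℝ) (j : Fin 3) (m : ℕ) :
    (∑' x : Site 3, ((x j : ℤ) : ℝ) ^ 4 *
        Real.sqrt (∑ i, ((x i : ℤ) : ℝ) ^ 2) ^ (2 * m) * twoPointFree 3 β x) =
      ∑' x : Site 3, ((x 0 : ℤ) : ℝ) ^ 4 *
        Real.sqrt (∑ i, ((x i : ℤ) : ℝ) ^ 2) ^ (2 * m) * twoPointFree 3 β x := by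
  set π : Equiv.Perm (Fin 3) := Equiv.swap 0 j with hπ
  rw [← Equiv.tsum_eq (Site.signedPerm π 1) (fun x : Site 3 => ((x 0 : ℤ) : ℝ) ^ 4 *
    Real.sqrt (∑ i, ((x i : ℤ) : ℝ) ^ 2) ^ (2 * m) * twoPointFree 3 β x)]
  refine tsum_congr fun x => ?_
  rw [twoPointFree_signedPerm, euclid_signedPerm, Site.signedPerm_apply]
  have h0 : π.symm 0 = j := by
    rw [hπ, Equiv.symm_swap, Equiv.swap_apply_left]
  simp [h0]

/-- **The axial fourth moment in terms of the `K₄` and isotropic moments.**  For `0 ≤ β < β_c(3)`: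
`∑_x x₀⁴|x|^{2m}G_β(x) = (1/3)∑_x K₄(x)|x|^{2m}G_β(x) + (1/5)∑_x |x|^{4+2m}G_β(x)`. -/
theorem axialFourthMoment_eq {β : ℝ} (hβ : 0 ≤ β) (hβc : β < criticalBeta 3) (m : ℕ) :
    (∑' x : Site 3, ((x 0 : ℤ) : ℝ) ^ 4 *
        Real.sqrt (∑ i, ((x i : ℤ) : ℝ) ^ 2) ^ (2 * m) * twoPointFree 3 β x) =
      1 / 3 * (∑' x : Site 3, ((∑ i : Fin 3, ((x i : ℤ) : ℝ) ^ 4) -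
          3 / 5 * (∑ i : Fin 3, ((x i : ℤ) : ℝ) ^ 2) ^ 2) *
          Real.sqrt (∑ i, ((x i : ℤ) : ℝ) ^ 2) ^ (2 * m) * twoPointFree 3 β x) +
      1 / 5 * (∑' x : Site 3, Real.sqrt (∑ i, ((x i : ℤ) : ℝ) ^ 2) ^ (4 + 2 * m) *
          twoPointFree 3 β x) := by
  -- the three axial moments are equal, and add up to the `∑ᵢ xᵢ⁴` moment
  have hsum3 : (∑' x : Site 3, (∑ j : Fin 3, ((x j : ℤ) : ℝ) ^ 4) *
      Real.sqrt (∑ i, ((x i : ℤ) : ℝ) ^ 2) ^ (2 * m) * twoPointFree 3 β x) =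
      3 * ∑' x : Site 3, ((x 0 : ℤ) : ℝ) ^ 4 *
        Real.sqrt (∑ i, ((x i : ℤ) : ℝ) ^ 2) ^ (2 * m) * twoPointFree 3 β x := by
    have h1 : (∑' x : Site 3, (∑ j : Fin 3, ((x j : ℤ) : ℝ) ^ 4) *
        Real.sqrt (∑ i, ((x i : ℤ) : ℝ) ^ 2) ^ (2 * m) * twoPointFree 3 β x) =
        ∑' x : Site 3, ∑ j : Fin 3, ((x j : ℤ) : ℝ) ^ 4 *
          Real.sqrt (∑ i, ((x i : ℤ) : ℝ) ^ 2) ^ (2 * m) * twoPointFree 3 β x :=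
      tsum_congr fun x => by rw [Finset.sum_mul, Finset.sum_mul]
    rw [h1, Summable.tsum_finsetSum (fun j _ => summable_axialFourth hβ hβc j m)]
    simp_rw [axialFourth_eq_axialFourth_zero β _ m]
    rw [Finset.sum_const, Finset.card_univ, Fintype.card_fin, nsmul_eq_mul]
    norm_num
  -- `∑ᵢ xᵢ⁴ = K₄ + (3/5)|x|⁴` termwise
  have hK : Summable fun x : Site 3 => ((∑ i : Fin 3, ((x i : ℤ) : ℝ) ^ 4) -
      3 / 5 * (∑ i : Fin 3, ((x i : ℤ) : ℝ) ^ 2) ^ 2) *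
        Real.sqrt (∑ i, ((x i : ℤ) : ℝ) ^ 2) ^ (2 * m) * twoPointFree 3 β x := by
    refine (summable_polyMoment hβ hβc _ K4poly_isHomogeneous m).congr (fun x => ?_)
    rw [eval_K4poly]
  have hM : Summable fun x : Site 3 =>
      Real.sqrt (∑ i, ((x i : ℤ) : ℝ) ^ 2) ^ (4 + 2 * m) * twoPointFree 3 β x :=
    summable_moment hβ hβc (4 + 2 * m)
  have hsplit : (∑' x : Site 3, (∑ j : Fin 3, ((x j : ℤ) : ℝ) ^ 4) *
      Real.sqrt (∑ i, ((x i : ℤ) : ℝ) ^ 2) ^ (2 * m) * twoPointFree 3 β x) =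
      (∑' x : Site 3, ((∑ i : Fin 3, ((x i : ℤ) : ℝ) ^ 4) -
          3 / 5 * (∑ i : Fin 3, ((x i : ℤ) : ℝ) ^ 2) ^ 2) *
          Real.sqrt (∑ i, ((x i : ℤ) : ℝ) ^ 2) ^ (2 * m) * twoPointFree 3 β x) +
      3 / 5 * (∑' x : Site 3, Real.sqrt (∑ i, ((x i : ℤ) : ℝ) ^ 2) ^ (4 + 2 * m) *
          twoPointFree 3 β x) := by
    rw [← tsum_mul_left, ← hK.tsum_add (hM.mul_left _)]
    refine tsum_congr fun x => ?_
    have hsq : (∑ i : Fin 3, ((x i : ℤ) : ℝ) ^ 2) ^ 2 = Real.sqrt (∑ i, ((x i : ℤ) : ℝ) ^ 2) ^ 4 := by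
      rw [show (4 : ℕ) = 2 * 2 by norm_num, pow_mul,
        Real.sq_sqrt (Finset.sum_nonneg fun i _ => sq_nonneg _)]
    rw [pow_add, hsq]
    ring
  rw [hsplit] at hsum3
  linarith

/-- The isotropic moments are eventually positive as `β ↑ β_c` (they tend to `+∞`). -/
theorem eventually_moment_pos (q : ℕ) (hq : 1 ≤ q) :
    ∀ᶠ β in 𝓝[<] criticalBeta 3,
      0 < ∑' x : Site 3, Real.sqrt (∑ i, ((x i : ℤ) : ℝ) ^ 2) ^ q * twoPointFree 3 β x :=
  (tendsto_moment_atTop hq).eventually_gt_atTop 0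

/-- **The `K₄` family as an axial fourth moment.**  The `K₄` anisotropy ratios tend to `0` for
every radial order `m` iff the normalised axial fourth moments tend to the isotropic value `1/5`:
`∑_x x₀⁴|x|^{2m}G_β(x) / ∑_x |x|^{4+2m}G_β(x) → 1/5` as `β ↑ β_c(3)`, for every `m`. -/
theorem K4_family_iff_axialFourthMoment :
    (∀ m : ℕ, Tendsto (fun β => (∑' x : Site 3, ((∑ i : Fin 3, ((x i : ℤ) : ℝ) ^ 4) -
          3 / 5 * (∑ i : Fin 3, ((x i : ℤ) : ℝ) ^ 2) ^ 2) *
          Real.sqrt (∑ i, ((x i : ℤ) : ℝ) ^ 2) ^ (2 * m) * twoPointFree 3 β x) /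
        (∑' x : Site 3, Real.sqrt (∑ i, ((x i : ℤ) : ℝ) ^ 2) ^ (4 + 2 * m) *
          twoPointFree 3 β x))
      (𝓝[<] criticalBeta 3) (𝓝 0)) ↔
    (∀ m : ℕ, Tendsto (fun β => (∑' x : Site 3, ((x 0 : ℤ) : ℝ) ^ 4 *
          Real.sqrt (∑ i, ((x i : ℤ) : ℝ) ^ 2) ^ (2 * m) * twoPointFree 3 β x) /
        (∑' x : Site 3, Real.sqrt (∑ i, ((x i : ℤ) : ℝ) ^ 2) ^ (4 + 2 * m) *
          twoPointFree 3 β x))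
      (𝓝[<] criticalBeta 3) (𝓝 (1 / 5))) := by
  have hβc : 0 < criticalBeta 3 := criticalBeta_pos_holds (by norm_num)
  -- on a left neighbourhood of `β_c`: axial ratio = (1/3)·(K₄ ratio) + 1/5
  have key : ∀ m : ℕ, ∀ᶠ β in 𝓝[<] criticalBeta 3,
      (∑' x : Site 3, ((x 0 : ℤ) : ℝ) ^ 4 *
          Real.sqrt (∑ i, ((x i : ℤ) : ℝ) ^ 2) ^ (2 * m) * twoPointFree 3 β x) /
        (∑' x : Site 3, Real.sqrt (∑ i, ((x i : ℤ) : ℝ) ^ 2) ^ (4 + 2 * m) *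
          twoPointFree 3 β x) =
      1 / 3 * ((∑' x : Site 3, ((∑ i : Fin 3, ((x i : ℤ) : ℝ) ^ 4) -
          3 / 5 * (∑ i : Fin 3, ((x i : ℤ) : ℝ) ^ 2) ^ 2) *
          Real.sqrt (∑ i, ((x i : ℤ) : ℝ) ^ 2) ^ (2 * m) * twoPointFree 3 β x) /
        (∑' x : Site 3, Real.sqrt (∑ i, ((x i : ℤ) : ℝ) ^ 2) ^ (4 + 2 * m) *
          twoPointFree 3 β x)) + 1 / 5 := by
    intro m
    filter_upwards [Ioo_mem_nhdsLT hβc, eventually_moment_pos (4 + 2 * m) (by omega)] with β hβ hM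
    rw [axialFourthMoment_eq hβ.1.le hβ.2 m, add_div, mul_div_assoc, mul_div_assoc, div_self hM.ne',
      mul_one]
  constructor
  · intro h m
    have hlim := ((h m).const_mul (1 / 3)).add_const (1 / 5)
    rw [mul_zero, zero_add] at hlim
    exact hlim.congr' ((key m).mono fun β hβ => hβ.symm)
  · intro h m
    have hlim := ((h m).sub_const (1 / 5)).const_mul 3
    rw [sub_self, mul_zero] at hlim
    refine hlim.congr' ((key m).mono fun β hβ => ?_)
    rw [hβ]
    ring

/-- **`HarmonicDilution` as a limit of a positive lattice sum.**  The milestone (item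
stmt-CriticalPhenomena-6034) implies, for every `m ≥ 0`,
`∑_x x₀⁴|x|^{2m}⟨σ₀σ_x⟩^∅_β / ∑_x |x|^{4+2m}⟨σ₀σ_x⟩^∅_β → 1/5` as `β ↑ β_c(3)` — the normalised axial
fourth moment of the subcritical two-point function reaches its isotropic value
`∫_{S²} ω₀⁴ dσ(ω)/4π = 1/5` at criticality (for orientation: on the nearest-neighbour shell alone the
ratio is `∑_{|x|=1} x₀⁴ / ∑_{|x|=1} |x|⁴ = 1/3`; the content of the item in degree `4` is exactly this
limit, `harmonicDilution_degree_four_iff_K4` and `K4_family_iff_axialFourthMoment`). -/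
theorem harmonicDilution_axialFourthMoment (h : HarmonicDilution) (m : ℕ) :
    Tendsto (fun β => (∑' x : Site 3, ((x 0 : ℤ) : ℝ) ^ 4 *
          Real.sqrt (∑ i, ((x i : ℤ) : ℝ) ^ 2) ^ (2 * m) * twoPointFree 3 β x) /
        (∑' x : Site 3, Real.sqrt (∑ i, ((x i : ℤ) : ℝ) ^ 2) ^ (4 + 2 * m) *
          twoPointFree 3 β x))
      (𝓝[<] criticalBeta 3) (𝓝 (1 / 5)) := by
  refine K4_family_iff_axialFourthMoment.1 (fun m' => ?_) m
  dsimp only [HarmonicDilution] at h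
  have hm := h 4 m' _ (by norm_num) K4poly_isHomogeneous K4poly_harmonic
  refine hm.congr (fun β => ?_)
  rw [tsum_congr (fun x => by rw [eval_K4poly])]

/-- **The item, with its first instance in measurable form.**  `HarmonicDilution` is equivalent to
the conjunction of (i) the axial fourth-moment limits
`∑_x x₀⁴|x|^{2m}G_β(x) / ∑_x |x|^{4+2m}G_β(x) → 1/5` (`β ↑ β_c(3)`, every `m`) and (ii) its
restriction to the `B₃`-invariant harmonic homogeneous `Y` of even degree `n ≥ 6`. -/
theorem harmonicDilution_iff_axialFourthMoment_and_invariant_six_le :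
    HarmonicDilution ↔
      ((∀ m : ℕ, Tendsto (fun β => (∑' x : Site 3, ((x 0 : ℤ) : ℝ) ^ 4 *
            Real.sqrt (∑ i, ((x i : ℤ) : ℝ) ^ 2) ^ (2 * m) * twoPointFree 3 β x) /
          (∑' x : Site 3, Real.sqrt (∑ i, ((x i : ℤ) : ℝ) ^ 2) ^ (4 + 2 * m) *
            twoPointFree 3 β x))
        (𝓝[<] criticalBeta 3) (𝓝 (1 / 5))) ∧
      ∀ (n m : ℕ) (Y : MvPolynomial (Fin 3) ℝ), 6 ≤ n → Even n → Y.IsHomogeneous n →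
        (∑ i : Fin 3, MvPolynomial.pderiv i (MvPolynomial.pderiv i Y)) = 0 →
        (∀ (π : Equiv.Perm (Fin 3)) (ε : Fin 3 → ℤˣ) (v : Fin 3 → ℝ),
          MvPolynomial.eval (fun i => ((ε i : ℤ) : ℝ) * v (π.symm i)) Y = MvPolynomial.eval v Y) →
        Tendsto (fun β => (∑' x : Site 3, MvPolynomial.eval (fun i => ((x i : ℤ) : ℝ)) Y *
              Real.sqrt (∑ i, ((x i : ℤ) : ℝ) ^ 2) ^ (2 * m) * twoPointFree 3 β x) /
            (∑' x : Site 3, Real.sqrt (∑ i, ((x i : ℤ) : ℝ) ^ 2) ^ (n + 2 * m) *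
              twoPointFree 3 β x))
          (𝓝[<] criticalBeta 3) (𝓝 0)) :=
  harmonicDilution_iff_K4_and_invariant_six_le.trans (and_congr K4_family_iff_axialFourthMoment Iff.rfl)

end Summit.CriticalPhenomena.Ising3DConformalLimit.Theorems
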